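import Literature.Geometry.Lorentzian.CorrespondingBoundaryExtension
import Literature.Geometry.Lorentzian.SpacelikeCorrespondingBoundaryPoint
import Literature.Geometry.Lorentzian.SpacelikeBoundaryLevelSet
import HarnessLib

/-!
# Boundary data at a spacelike corresponding boundary point of a common development
# (Sbierski 2016, §3.2: Lemmas 14–16 and the level set of `τ_q`, assembled), pure form

J. Sbierski, Ann. Henri Poincaré 17 (2016) 301–329 = arXiv:1309.7591v3, §3.2, proof of Thm. 12:
*"Without loss of generality we can assume that `C ∩ J⁺(ι(M̄))` is non empty, and thus, by
Lemma 15, we can find a `p ∈ C` which satisfies `J⁻(p) ∩ ∂U ∩ J⁺(ι(M̄)) = {p}`. Since by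
Lemma 14 `C` is open in `∂U`, we can find a … neighbourhood `V` of `p` such that `V ∩ ∂U ⊆ C` …
[Lemma 16, the maximum `τ₀` of `τ_q`, the hypersurface `S = τ_q⁻¹(τ₀)`] … Using Lemma 14 … we
can thus map `S` isometrically to `ψ(S) ⊆ M'`"*.

**Theorem (`LorentzianMetric.exists_boundaryData_future`).** In the pure two-manifold setting of
`CorrespondingBoundaryExtension.lean` / `CorrespondingBoundaryTendsto.lean` (strongly causal
time-oriented Lorentzian `d`-manifolds `M ⊇ U ⊇ Σ`, `M' ⊇ W' ⊇ Σ'` with `Σ`, `Σ'` Cauchy in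
`M`, `M'` and in the open sub-spacetimes `U`, `W'`; an isometric immersion `ψ : (U, g|_U) → M'`
with extension `Ψ` and inverse `φ` between `U` and `W'`, both carrying timelike curves to timelike
curves; the global-hyperbolicity consequences displayed), if some boundary point `p ∈ ∂U ∩ I⁺(Σ)`
has a corresponding point `p'` (neighbourhood condition of Sbierski's Def. 11), then there are a
boundary point `p₀ ∈ ∂U ∩ I⁺(Σ)`, an open `W ∋ p₀`, a function `f` and a map `Φ : M → M'` with:
`f`, `Φ` of class `C^∞` on `W`, `f p₀ = 0`, `df_{p₀}` positive on the future cone,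
`{f = 0} ∩ W ⊆ Ū`, `Φ = ψ` on `W ∩ U`, `dΦ_{p₀}` injective — the boundary data (H1)–(H4) of the
restart of the local uniqueness theorem
(`Summit.FinalStateConjecture.….SubdataDevelopmentsEmbed.restart_of_locallyUnique`,
hypothesis `hbd` of `….thm12_of_locallyUnique_of_boundaryData`).

Assembly: partners of future boundary points lie in `I⁺(Σ')`
(`mem_chronologicalFuture_glue_of_corresponding`), so Prop. 13 (ii) holds at every corresponding
pair (`tendsto_of_corresponding_future`) and Lemma 14 applies there
(`exists_extension_of_corresponding_future`), which makes the set `C` of corresponding boundary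
points open in `∂U` (its last clause with Prop. 13 (iii) ⇒ (i)); Lemma 15
(`exists_spacelikeCorrespondingPoint`) gives a spacelike corresponding point `p₁`; the level-set
construction (`IsCauchyHypersurface.exists_levelSet_boundaryPoint`) inside the Lemma-14
neighbourhood of `p₁` gives `p₀`, `f` with (H1)–(H3) and `p₀ ∈ C`; Lemma 14 at `p₀` gives `Φ`.

Everything is proved; no definitions, no named facts (D-0026). The time dual and the instance for
common globally hyperbolic developments of the tree's Cauchy developments follow downstream.

## References

* J. Sbierski, Ann. Henri Poincaré 17 (2016) 301–329 = arXiv:1309.7591v3, §3.2 (arXiv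
  numbering: Prop. 13, Lemmas 14–16, proof of Thm. 12). [Sbierski2016AHP]
* H. Ringström, *The Cauchy Problem in General Relativity*, EMS 2009, Ch. 23. [Ringstrom2009]
-/

noncomputable section

open Bundle Set Filter Function Metric TopologicalSpace Topology
open scoped Manifold ContDiff Topology

namespace Literature.Geometry.Lorentzian

open Literature.Geometry.Riemannian

section Core

variable {d : ℕ} {M : Type*} [TopologicalSpace M] [ChartedSpace (EuclideanSpace ℝ (Fin d)) M]
  [IsManifold (𝓡 d) ∞ M] [T2Space M] [SecondCountableTopology M]
  {M' : Type*} [TopologicalSpace M'] [ChartedSpace (EuclideanSpace ℝ (Fin d)) M']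
  [IsManifold (𝓡 d) ∞ M'] [T2Space M'] [SecondCountableTopology M']

namespace LorentzianMetric

variable {g : LorentzianMetric (𝓡 d) ∞ M} [g.HasLeviCivita]
  [CovariantDerivative.ContMDiffCovariantDerivative g.leviCivita 1] (τ : TimeOrientation g)
  {g' : LorentzianMetric (𝓡 d) ∞ M'} [g'.HasLeviCivita]
  [CovariantDerivative.ContMDiffCovariantDerivative g'.leviCivita 1] (τ' : TimeOrientation g')

/-- **Boundary data (H1)–(H4) at a spacelike corresponding boundary point, future case, pure
form** (Sbierski 2016, §3.2, Lemmas 14–16 and the level set of `τ_q` in the proof of Thm. 12;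
see the module docstring for the setting, the statement and the assembly).
[cite: Sbierski2016AHP, §3.2, proof of Thm. 12 with Prop. 13 and Lemmas 14–16 (arXiv numbering)] -/
theorem exists_boundaryData_future (U : Opens M)
    [(g.toPseudoRiemannianMetric.restrict PseudoRiemannianMetric.contMDiff_restrict_holds U).HasLeviCivita]
    [CovariantDerivative.ContMDiffCovariantDerivative
      (g.toPseudoRiemannianMetric.restrict PseudoRiemannianMetric.contMDiff_restrict_holds U).leviCivita 1]
    {Sig : Set M} (hSig : g.IsCauchyHypersurface τ Sig) (hSigU : Sig ⊆ U)
    (hU : (g.restrict PseudoRiemannianMetric.contMDiff_restrict_holds U).IsCauchyHypersurface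
      (τ.restrict PseudoRiemannianMetric.contMDiff_restrict_holds τ.contMDiff_restrict_holds U)
      (Subtype.val ⁻¹' Sig))
    {Sig' : Set M'} (hSig' : g'.IsCauchyHypersurface τ' Sig') {W' : Opens M'}
    (hW' : (g'.restrict PseudoRiemannianMetric.contMDiff_restrict_holds W').IsCauchyHypersurface
      (τ'.restrict PseudoRiemannianMetric.contMDiff_restrict_holds τ'.contMDiff_restrict_holds W')
      (Subtype.val ⁻¹' Sig'))
    (hSC : g.IsStronglyCausal τ) (hSC' : g'.IsStronglyCausal τ') (hcaus : g.IsCausallyWellBehaved τ)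
    (hK₁ : ∀ x : M, IsCompact (g.causalPast τ {x} ∩ g.causalFuture τ Sig))
    (hK₂ : ∀ x' : M', IsCompact (g'.causalPast τ' {x'} ∩ g'.causalFuture τ' Sig'))
    (hrel₁ : ∀ {xs ys : ℕ → M} {x y : M}, Tendsto xs atTop (𝓝 x) → Tendsto ys atTop (𝓝 y) →
      (∀ j, ys j ∈ g.causalFuture τ {xs j}) → y ∈ g.causalFuture τ {x})
    (hrel₂ : ∀ {xs ys : ℕ → M'} {x y : M'}, Tendsto xs atTop (𝓝 x) → Tendsto ys atTop (𝓝 y) →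
      (∀ j, ys j ∈ g'.causalFuture τ' {xs j}) → y ∈ g'.causalFuture τ' {x})
    (hJ₁ : ∀ x : M, IsClosed (g.causalPast τ {x}))
    {ψ : U → M'}
    (hψ : (g.restrict PseudoRiemannianMetric.contMDiff_restrict_holds U).IsIsometricImmersion
      g'.toPseudoRiemannianMetric ψ)
    {Ψ : M → M'} (hΨψ : ∀ (q : M) (hq : q ∈ U), Ψ q = ψ ⟨q, hq⟩)
    (hΨcurve : ∀ (γ : ℝ → M) (s : Set ℝ), g.IsFutureTimelikeCurveOn τ γ s →
      (∀ t ∈ s, γ t ∈ U) → g'.IsFutureTimelikeCurveOn τ' (Ψ ∘ γ) s)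
    (hΨW : MapsTo Ψ U W') (hΨS : Ψ '' Sig ⊆ Sig')
    {φ : M' → M} (hφU : MapsTo φ W' U) (hφΨ : ∀ y ∈ (U : Set M), φ (Ψ y) = y)
    (hΨφ : ∀ z ∈ (W' : Set M'), Ψ (φ z) = z)
    (hφcurve : ∀ (γ : ℝ → M') (s : Set ℝ), g'.IsFutureTimelikeCurveOn τ' γ s →
      (∀ t ∈ s, γ t ∈ W') → g.IsFutureTimelikeCurveOn τ (φ ∘ γ) s)
    {p : M} (hp : p ∈ frontier (U : Set M)) (hpI : p ∈ g.chronologicalFuture τ Sig) {p' : M'}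
    (hcorr : ∀ V ∈ 𝓝 p, ∀ V' ∈ 𝓝 p', ∃ y ∈ (U : Set M), y ∈ V ∧ Ψ y ∈ V') :
    ∃ (p₀ : M) (W : Set M) (f : M → ℝ) (Φ : M → M'), p₀ ∉ U ∧
      p₀ ∈ g.chronologicalFuture τ Sig ∧ IsOpen W ∧ p₀ ∈ W ∧
      ContMDiffOn (𝓡 d) 𝓘(ℝ, ℝ) ∞ f W ∧ f p₀ = 0 ∧
      (∀ v : TangentSpace (𝓡 d) p₀, τ.IsFutureDirected v → (0 : ℝ) < mfderiv (𝓡 d) 𝓘(ℝ, ℝ) f p₀ v) ∧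
      (∀ q ∈ W, f q = 0 → q ∈ closure (U : Set M)) ∧
      ContMDiffOn (𝓡 d) (𝓡 d) ∞ Φ W ∧ (∀ q ∈ W, ∀ (hq : q ∈ U), Φ q = ψ ⟨q, hq⟩) ∧
      Injective (mfderiv (𝓡 d) (𝓡 d) Φ p₀) := by
  have hn2 : (2 : ℕ∞ω) ≤ ∞ := WithTop.coe_le_coe.mpr le_top
  set hres := (PseudoRiemannianMetric.contMDiff_restrict_holds :
    PseudoRiemannianMetric.contMDiff_restrict (I := 𝓡 d) (n := ∞) (M := M)) with hres_def
  set hres' := (PseudoRiemannianMetric.contMDiff_restrict_holds :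
    PseudoRiemannianMetric.contMDiff_restrict (I := 𝓡 d) (n := ∞) (M := M')) with hres'_def
  -- transport of `≪` along `Ψ` and `φ`
  have hpush : ∀ ⦃γ : ℝ → M⦄ ⦃a b : ℝ⦄, a < b → g.IsFutureTimelikeCurveOn τ γ (Icc a b) →
      (∀ t ∈ Icc a b, γ t ∈ U) → Ψ (γ b) ∈ g'.chronologicalFuture τ' {Ψ (γ a)} :=
    fun γ a b hab hγ hγU ↦ ⟨Ψ (γ a), rfl, Ψ ∘ γ, a, b, hab, hΨcurve γ _ hγ hγU, rfl, rfl⟩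
  have hpushφ : ∀ ⦃γ : ℝ → M'⦄ ⦃a b : ℝ⦄, a < b → g'.IsFutureTimelikeCurveOn τ' γ (Icc a b) →
      (∀ t ∈ Icc a b, γ t ∈ W') → φ (γ b) ∈ g.chronologicalFuture τ {φ (γ a)} :=
    fun γ a b hab hγ hγW ↦ ⟨φ (γ a), rfl, φ ∘ γ, a, b, hab, hφcurve γ _ hγ hγW, rfl, rfl⟩
  -- partners of future boundary points lie in `I⁺(Σ')`
  have hpartI : ∀ {x : M} {x' : M'}, x ∈ frontier (U : Set M) → x ∈ g.chronologicalFuture τ Sig →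
      (∀ V ∈ 𝓝 x, ∀ V' ∈ 𝓝 x', ∃ y ∈ (U : Set M), y ∈ V ∧ Ψ y ∈ V') →
      x' ∈ g'.chronologicalFuture τ' Sig' := by
    intro x x' hx hxI hc
    obtain ⟨r, r₁, hrU, hr₁U, hrI, hrr₁, hxr₁⟩ := exists_mem_opens_ll_ll hn2 hres τ.contMDiff_restrict_holds
      hSig hU hx hxI
    exact (mem_chronologicalFuture_glue_of_corresponding hn2 hn2 hres τ.contMDiff_restrict_holds hSig hSigU
      hU hSig' hΨS rfl hpush hrel₂ hc hrU hr₁U hrI hrr₁ hxr₁).2.2.1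
  -- Prop. 13 (ii) at corresponding pairs, and Lemma 14 there
  have hL14 : ∀ {x : M} {x' : M'}, x ∈ frontier (U : Set M) → x ∈ g.chronologicalFuture τ Sig →
      (∀ V ∈ 𝓝 x, ∀ V' ∈ 𝓝 x', ∃ y ∈ (U : Set M), y ∈ V ∧ Ψ y ∈ V') →
      ∃ (W : Set M) (Φ : M → M'), IsOpen W ∧ x ∈ W ∧ W ⊆ g.chronologicalFuture τ Sig ∧
        ContMDiffOn (𝓡 d) (𝓡 d) ∞ Φ W ∧ (∀ q ∈ W, ∀ (hq : q ∈ U), Φ q = ψ ⟨q, hq⟩) ∧ Φ x = x' ∧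
        Injective (mfderiv (𝓡 d) (𝓡 d) Φ x) ∧
        ∀ q ∈ W, q ∈ frontier (U : Set M) → ∃ γ : ℝ → M,
          g.IsFutureTimelikeCurveOn τ γ (Ico 0 1) ∧ (∀ t ∈ Ico (0 : ℝ) 1, γ t ∈ U) ∧
          Tendsto γ (𝓝[<] 1) (𝓝 q) ∧ Tendsto (Ψ ∘ γ) (𝓝[<] 1) (𝓝 (Φ q)) := by
    intro x x' hx hxI hc
    exact exists_extension_of_corresponding_future τ τ' U hSig hU hSC hSC' hψ hΨψ hΨcurve hx hxI
      fun γ a b hab hγ hγU hlim ↦ tendsto_of_corresponding_future hn2 hn2 hres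
        τ.contMDiff_restrict_holds hSig hU hres' τ'.contMDiff_restrict_holds hSig' hW' hΨW hφU hφΨ hΨφ
        hpush hpushφ hrel₁ hrel₂ hSC' (hpartI hx hxI hc) hc hab hγ hγU hlim
  -- corresponding-ness from limits (Prop. 13 (iii) ⇒ (i), neighbourhood form)
  have hcorr_of : ∀ {x : M} {x' : M'} (γ : ℝ → M), (∀ t ∈ Ico (0 : ℝ) 1, γ t ∈ U) →
      Tendsto γ (𝓝[<] 1) (𝓝 x) → Tendsto (Ψ ∘ γ) (𝓝[<] 1) (𝓝 x') →
      ∀ V ∈ 𝓝 x, ∀ V' ∈ 𝓝 x', ∃ y ∈ (U : Set M), y ∈ V ∧ Ψ y ∈ V' := by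
    intro x x' γ hγU h1 h2 V hV V' hV'
    have h1' : ∀ᶠ t in 𝓝[<] (1 : ℝ), γ t ∈ V := h1 hV
    have h2' : ∀ᶠ t in 𝓝[<] (1 : ℝ), (Ψ ∘ γ) t ∈ V' := h2 hV'
    obtain ⟨t, ⟨htV, htV'⟩, ht⟩ := ((h1'.and h2').and (Ico_mem_nhdsLT zero_lt_one)).exists
    exact ⟨γ t, hγU t ht, htV, htV'⟩
  -- `C` is open in `∂U` (Lemma 14)
  have hopen : ∀ z ∈ frontier (U : Set M), z ∈ g.chronologicalFuture τ Sig → ∀ z' : M',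
      (∀ V ∈ 𝓝 z, ∀ V' ∈ 𝓝 z', ∃ y ∈ (U : Set M), y ∈ V ∧ Ψ y ∈ V') →
      ∃ V ∈ 𝓝 z, ∀ w ∈ V, w ∈ frontier (U : Set M) →
        ∃ w' : M', ∀ O ∈ 𝓝 w, ∀ O' ∈ 𝓝 w', ∃ y ∈ (U : Set M), y ∈ O ∧ Ψ y ∈ O' := by
    intro z hz hzI z' hc
    obtain ⟨Wz, Φz, hWo, hzW, -, -, -, -, -, hbdry⟩ := hL14 hz hzI hc
    refine ⟨Wz, hWo.mem_nhds hzW, fun w hw hwfr ↦ ?_⟩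
    obtain ⟨γ, -, hγU, h1, h2⟩ := hbdry w hw hwfr
    exact ⟨Φz w, hcorr_of γ hγU h1 h2⟩
  -- Lemma 15: a spacelike corresponding boundary point `p₁`
  obtain ⟨p₁, hp₁fr, hp₁I, ⟨p₁', hc₁⟩, hsp⟩ := exists_spacelikeCorrespondingPoint hn2 hn2 hres
    τ.contMDiff_restrict_holds hSig hSigU hU hres' τ'.contMDiff_restrict_holds hSig' hW' hΨW hφU hφΨ hΨφ
    hΨS hpush hpushφ hrel₁ hrel₂ hSC' hK₁ hJ₁ hcaus hK₂ hopen hp hpI hcorr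
  -- Lemma 14 at `p₁`, and the level set inside its neighbourhood
  obtain ⟨W₁, Φ₁, hW₁o, hp₁W₁, -, -, -, -, -, hbdry₁⟩ := hL14 hp₁fr hp₁I hc₁
  obtain ⟨p₀, O, f, hp₀W₁, hp₀fr, hp₀I, hOo, hp₀O, hfs, hf0, hdf, hlevel⟩ :=
    IsCauchyHypersurface.exists_levelSet_boundaryPoint τ le_rfl hres τ.contMDiff_restrict_holds hSig hSigU
      hU hK₁ hrel₁ hSC hcaus hp₁fr hp₁I hsp (hW₁o.mem_nhds hp₁W₁)
  -- `p₀ ∈ C`; Lemma 14 at `p₀`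
  obtain ⟨γ₀, -, hγ₀U, h1, h2⟩ := hbdry₁ p₀ hp₀W₁ hp₀fr
  have hc₀ := hcorr_of γ₀ hγ₀U h1 h2
  obtain ⟨W₀, Φ₀, hW₀o, hp₀W₀, -, hΦ₀s, hΦ₀ψ, -, hΦ₀inj, -⟩ := hL14 hp₀fr hp₀I hc₀
  refine ⟨p₀, O ∩ W₀, f, Φ₀, fun h ↦ (eq_empty_iff_forall_notMem.1 U.2.inter_frontier_eq) _ ⟨h, hp₀fr⟩,
    hp₀I, hOo.inter hW₀o, ⟨hp₀O, hp₀W₀⟩, hfs.mono inter_subset_left, hf0, hdf,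
    fun q hq ↦ hlevel q hq.1, hΦ₀s.mono inter_subset_right, fun q hq hqU ↦ hΦ₀ψ q hq.2 hqU, hΦ₀inj⟩

end LorentzianMetric

end Core

end Literature.Geometry.Lorentzian

end
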